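import Literature.Probability.RandomPlanarGeometry.RestrictionMeasuresFiveEighths
import Literature.Probability.RandomPlanarGeometry.RestrictionSides
import Literature.Probability.RandomPlanarGeometry.RestrictionReflection
import Literature.Probability.RandomPlanarGeometry.OneSidedRestriction
import HarnessLib

/-!
# The law of `Fill₋(K)` under `P_α` is `P⁺_α`; [LSW] Cor. 8.6 from Thm. 8.4, and p. 5 result 2 from its two printed leaves

Level 3 of the decomposition of the named fact
`Literature.Probability.RandomPlanarGeometry.IsRestrictionMeasure.eq_five_eighths_of_outer_simple`
(file `RestrictionMeasures`; plan in `RestrictionMeasuresFiveEighths`): the ELEMENTARY HALF of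
the proof of [LSW] Cor. 8.6, announced in `OneSidedRestriction`, after

* G. F. Lawler, O. Schramm, W. Werner, *Conformal restriction: the chordal case*, J. Amer. Math.
  Soc. **16** (2003) 917–955, arXiv:math/0209343 (**[LSW]**, arXiv page numbers), §8.1 p. 31
  ("For `α ≥ 5/8`, we may obtain `P⁺_α` by applying `F^{ℝ₊}_ℍ` to a sample from the two sided
  restriction measure `P_α`") and the proof of Cor. 8.6 (pp. 37–38): "the same symmetry
  argument shows that for any `α > 0`, if the two-sided probability measure with exponent
  `α > 0` exists, then the `P_α` probability that `i` ends up to the 'right' of `K` is at most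
  `1/2` […]. If `K` has law `P_α` with some `α < 5/8`, then `F^{ℝ₊}_ℍ(K)` has law `P⁺_α`, which
  is described using SLE(8/3, ρ) for some `ρ < 0`. This contradicts the fact that the
  probability that it passes to the left of `i` is at least `1/2`."

All PROVED, from the tree's `RestrictionSides` (the left filling `Fill₋(cl K) = leftFill K`,
the right and left domains, the crossing lemma), `RestrictionReflection` (`P_α` is
`σ`-invariant; the abstract symmetry bound) and `OneSidedRestriction` (`Ω₊`, `P⁺_α`, its
uniqueness, measurability of `{i ∉ K}`):

* `Literature.Probability.RandomPlanarGeometry.RestrictionConfig.leftFillConfig` — **the map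
  `F^{ℝ₊}_ℍ : Ω → Ω₊`, `K ↦ Fill₋(cl K)`** (`leftFill K ∈ Ω₊`: closed, connected, in `ℍ̄`, meeting
  `ℝ` in `(−∞, 0]`, with connected complement in `ℍ` — all in `RestrictionSides`); it is
  MEASURABLE for the avoidance σ-fields, because `(F^{ℝ₊}_ℍ)⁻¹{K' ∩ A = ∅} = {K ∩ A = ∅}` for
  `A ∈ 𝒬₊` (`RestrictionConfig.disjoint_leftFill_iff`: a `+`-hull avoided by `K` lies in the
  right domain);
* `Literature.Probability.RandomPlanarGeometry.IsRestrictionMeasure.map_leftFillConfig` — **the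
  image of `P_α` under `F^{ℝ₊}_ℍ` is `P⁺_α`** (§8.1 p. 31), for every exponent `α`:
  `P[Fill₋(K) ∩ A = ∅] = P[K ∩ A = ∅] = Φ'_A(0)^α` for `A ∈ 𝒬₊ ⊆ 𝒬*`;
* `Literature.Probability.RandomPlanarGeometry.RestrictionConfig.rightOf z = {K ∈ Ω : z ∈ rightDomain K}`
  — **"`z` is to the right of `K`"**; for `z ∈ ℍ` it is `(F^{ℝ₊}_ℍ)⁻¹{K' : z ∉ K'}`, hence
  measurable (`RightConfig.measurableSet_notMem`); the reflection `σ` carries the right domain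
  of `σ(K)` to the left domain of `K` (`rightDomain_reflect`), so `σ⁻¹(rightOf i) = {i ∈ leftDomain K}`
  is disjoint from `rightOf i` (`disjoint_rightDomain_leftDomain`, the crossing lemma), and the
  symmetry bound gives **`P_α(i is to the right of K) ≤ 1/2`**
  (`IsRestrictionMeasure.measure_rightOf_I_le_half`; [LSW] p. 38);
* `Literature.Probability.RandomPlanarGeometry.not_exists_isRestrictionMeasure_of_lt_five_eighths_of_oneSided`
  — **[LSW] Cor. 8.6 from its SLE(8/3, ρ) input**: the named fact
  `not_exists_isRestrictionMeasure_of_lt_five_eighths` (`RestrictionMeasuresFiveEighths`)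
  follows from `exists_isRightRestrictionMeasure_lt_five_eighths` (`OneSidedRestriction`:
  Thm. 8.4 with Lemma 8.3 and the first half of the proof of Cor. 8.6 — for `0 < α < 5/8`,
  `P⁺_α` exists and `P⁺_α{i ∉ K} > 1/2`): if `P_α` existed, `F^{ℝ₊}_ℍ(P_α) = P⁺_α` by uniqueness
  of `P⁺_α` (`IsRightRestrictionMeasure.unique`), and `P⁺_α{i ∉ K} = P_α(rightOf i) ≤ 1/2`;
* `Literature.Probability.RandomPlanarGeometry.IsRestrictionMeasure.eq_five_eighths_of_outer_simple_of_leaves`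
  — the target named fact ([LSW] p. 5 result 2, first sentence, outer reading) from the TWO
  PRINTED DEEP LEAVES that remain: `exists_isRightRestrictionMeasure_lt_five_eighths` (§8:
  SLE(8/3, ρ), Thm. 8.4) and `IsRestrictionMeasure.ae_interior_nonempty_of_gt_five_eighths`
  (§7: Thm. 7.3, SLE_κ with Brownian bubbles), through
  `IsRestrictionMeasure.eq_five_eighths_of_outer_simple_of_facts`; likewise the "only if" half
  of p. 5 result 1 (`five_eighths_le_of_exists_of_oneSided`).

Mathlib: `measurable_generateFrom`, `MeasureTheory.Measure.map_apply`,
`Homeomorph.image_connectedComponentIn`, `Homeomorph.image_closure`, `Set.image_compl_eq`.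
-/

noncomputable section

open Set Filter Topology MeasureTheory
open UpperHalfPlane (upperHalfPlaneSet)
open scoped NNReal ENNReal ComplexConjugate

namespace Literature.Probability.RandomPlanarGeometry

namespace RestrictionConfig

variable (K : RestrictionConfig)

/-! ### The map `F^{ℝ₊}_ℍ : Ω → Ω₊` -/

/-- **`Fill₋(cl K) ∈ Ω₊` for `K ∈ Ω`** ([LSW] §8.1 p. 31: the left filling of a two-sided sample
is a one-sided configuration): closed, connected, in the closed upper half-plane, meeting `ℝ`
exactly in `(−∞, 0]`, with `ℍ ∖ Fill₋(cl K)` connected (all proved in `RestrictionSides`).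
[cite: LawlerSchrammWerner2003Restriction, §8.1 p. 31] -/
theorem leftFill_mem_rightConfigs : K.leftFill ∈ rightConfigs :=
  ⟨K.isClosed_leftFill, K.isConnected_leftFill, K.leftFill_subset, K.leftFill_inter_range_ofReal,
    K.isConnected_upperHalfPlaneSet_diff_leftFill⟩

/-- **The map `F^{ℝ₊}_ℍ : Ω → Ω₊`, `K ↦ Fill₋(cl K)`** ([LSW] §2 p. 8 "Fillings"; §8.1 p. 31: "we
may obtain `P⁺_α` by applying `F^{ℝ₊}_ℍ` to a sample from the two sided restriction measure
`P_α`"). [cite: LawlerSchrammWerner2003Restriction, §8.1 p. 31 with §2 p. 8 (F^{ℝ₊}_ℍ)] -/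
def leftFillConfig : RightConfig :=
  ⟨K.leftFill, K.leftFill_mem_rightConfigs⟩

/-- The underlying set of `F^{ℝ₊}_ℍ(K)` is `Fill₋(cl K)`. [folklore] -/
@[simp] theorem coe_leftFillConfig : ((K.leftFillConfig : RightConfig) : Set ℂ) = K.leftFill := rfl

/-- A point of `ℍ` is off `Fill₋(cl K)` iff it lies in the right domain of `K`. [folklore] -/
theorem notMem_leftFill_iff {z : ℂ} (hz : 0 < z.im) : z ∉ K.leftFill ↔ z ∈ K.rightDomain := by
  simp only [leftFill, Set.mem_sdiff, mem_setOf_eq, not_and, not_not]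
  exact ⟨fun h ↦ h hz.le, fun h _ ↦ h⟩

/-- **`(F^{ℝ₊}_ℍ)⁻¹{K' ∩ A = ∅} = {K ∩ A = ∅}` for `A ∈ 𝒬₊`** (`Fill₋(cl K) ∩ A = ∅ ⟺ K ∩ A = ∅`,
`RestrictionConfig.disjoint_leftFill_iff`). [cite: LawlerSchrammWerner2003Restriction, §8.1 p. 31] -/
theorem leftFillConfig_preimage_avoid {A : Set ℂ} (hA : IsPlusHull A) :
    leftFillConfig ⁻¹' RightConfig.avoid A = avoid A := by
  ext K
  simp only [mem_preimage, RightConfig.mem_avoid, coe_leftFillConfig, mem_avoid]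
  exact K.disjoint_leftFill_iff hA

/-- **`F^{ℝ₊}_ℍ : Ω → Ω₊` is measurable** for the avoidance σ-fields (it pulls the generating
events `{K' ∩ A = ∅}`, `A ∈ 𝒬₊`, of `Ω₊` back to generating events of `Ω`, `𝒬₊ ⊆ 𝒬*`). [folklore] -/
theorem measurable_leftFillConfig : Measurable leftFillConfig := by
  refine measurable_generateFrom ?_
  rintro _ ⟨A, hA, rfl⟩
  rw [leftFillConfig_preimage_avoid hA]
  exact measurableSet_avoid hA.1

/-! ### The event "`z` is to the right of `K`" -/

/-- **"`z` is to the right of `K`"**: `z` lies in the right domain of `K` (the component of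
`ℂ ∖ (cl K ∪ conj(cl K))` containing the positive real axis; for `z ∈ ℍ̄`, the component of
`ℍ̄ ∖ cl K` bordering `[0, ∞)`, `RestrictionConfig.rightDomain_inter_eq`), i.e. `z ∉ Fill₋(cl K)`
— the event of the proof of [LSW] Cor. 8.6 (p. 38: "the `P_α` probability that `i` ends up to
the 'right' of `K`"). [cite: LawlerSchrammWerner2003Restriction, proof of Cor. 8.6 (p. 38)] -/
def rightOf (z : ℂ) : Set RestrictionConfig := {K | z ∈ K.rightDomain}

variable {K}

/-- Membership in `rightOf z`. [folklore] -/
@[simp] theorem mem_rightOf {z : ℂ} : K ∈ rightOf z ↔ z ∈ K.rightDomain := Iff.rfl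

variable (K)

/-- For `z ∈ ℍ`, `rightOf z = (F^{ℝ₊}_ℍ)⁻¹{K' : z ∉ K'}`. [folklore] -/
theorem leftFillConfig_preimage_setOf_notMem {z : ℂ} (hz : 0 < z.im) :
    leftFillConfig ⁻¹' {K' : RightConfig | z ∉ (K' : Set ℂ)} = rightOf z := by
  ext K
  simp only [mem_preimage, mem_setOf_eq, coe_leftFillConfig, mem_rightOf]
  exact K.notMem_leftFill_iff hz

/-- **`rightOf z` is measurable** for `z ∈ ℍ` (the pull-back of the measurable event
`{K' ∈ Ω₊ : z ∉ K'}`, `RightConfig.measurableSet_notMem`). [folklore] -/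
theorem measurableSet_rightOf {z : ℂ} (hz : 0 < z.im) : MeasurableSet (rightOf z) := by
  rw [← leftFillConfig_preimage_setOf_notMem hz]
  exact measurable_leftFillConfig (RightConfig.measurableSet_notMem hz)

/-! ### The reflection swaps the right and left domains -/

/-- `conj ∘ σ = σ ∘ conj` (both are `z ↦ −z`). [folklore] -/
theorem conj_imagAxisRefl (z : ℂ) : conj (imagAxisRefl z) = imagAxisRefl (conj z) := by
  simp

/-- `F*(σK) = σ(F*(K))` for the mirror double `F* = cl K ∪ conj(cl K)`. [folklore] -/
theorem mirrorClosure_reflect : (reflect K).mirrorClosure = imagAxisRefl '' K.mirrorClosure := by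
  have hcl : closure ((reflect K : RestrictionConfig) : Set ℂ) = imagAxisRefl '' closure (K : Set ℂ) := by
    rw [coe_reflect, imagAxisRefl.image_closure]
  ext z
  simp only [mirrorClosure, hcl, mem_union, mem_preimage, image_union, mem_image]
  refine or_congr Iff.rfl ⟨?_, ?_⟩
  · rintro ⟨w, hw, hwz⟩
    refine ⟨conj w, by simpa using hw, ?_⟩
    rw [← conj_imagAxisRefl, hwz, Complex.conj_conj]
  · rintro ⟨w, hw, rfl⟩
    exact ⟨conj w, hw, by rw [← conj_imagAxisRefl]⟩

/-- **`rightDomain (σK) = σ(leftDomain K)`**: `σ` is a homeomorphism carrying `F*(K)` to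
`F*(σK)` and `−1` to `1`. [folklore] -/
theorem rightDomain_reflect : (reflect K).rightDomain = imagAxisRefl '' K.leftDomain := by
  have h := imagAxisRefl.image_connectedComponentIn (s := K.mirrorClosureᶜ) (x := -1)
    K.neg_one_notMem_mirrorClosure
  rw [image_compl_eq imagAxisRefl.bijective, ← mirrorClosure_reflect,
    show imagAxisRefl (-1 : ℂ) = 1 by simp] at h
  exact h.symm

/-- `z` is to the right of `σK` iff `σz` is to the left of `K`. [folklore] -/
theorem mem_rightDomain_reflect_iff {z : ℂ} :
    z ∈ (reflect K).rightDomain ↔ imagAxisRefl z ∈ K.leftDomain := by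
  rw [rightDomain_reflect, ← imagAxisRefl_preimage, mem_preimage]

/-- **`σ⁻¹(rightOf i) = {i ∈ leftDomain K}`** (`σ i = i`). [folklore] -/
theorem reflect_preimage_rightOf_I :
    reflect ⁻¹' rightOf Complex.I = {K : RestrictionConfig | Complex.I ∈ K.leftDomain} := by
  ext K
  rw [mem_preimage, mem_rightOf, mem_rightDomain_reflect_iff, mem_setOf_eq,
    show imagAxisRefl Complex.I = Complex.I by simp]

/-- **`rightOf i` is disjoint from its mirror image** (the right and left domains are disjoint,
`RestrictionConfig.disjoint_rightDomain_leftDomain` — the crossing lemma). [folklore] -/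
theorem disjoint_rightOf_I_reflect_preimage :
    Disjoint (rightOf Complex.I) (reflect ⁻¹' rightOf Complex.I) := by
  rw [reflect_preimage_rightOf_I, Set.disjoint_left]
  intro K h₁ h₂
  exact Set.disjoint_left.1 K.disjoint_rightDomain_leftDomain h₁ h₂

end RestrictionConfig

open RestrictionConfig

/-! ### The law of `F^{ℝ₊}_ℍ(K)` under `P_α` is `P⁺_α`; the symmetry bound -/

/-- **The image of `P_α` under `F^{ℝ₊}_ℍ` is the right-sided restriction measure `P⁺_α`**
([LSW] §8.1 p. 31: "For `α ≥ 5/8`, we may obtain `P⁺_α` by applying `F^{ℝ₊}_ℍ` to a sample from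
the two sided restriction measure `P_α`"; valid for every exponent for which `P_α` is given):
for `A ∈ 𝒬₊ ⊆ 𝒬*`, `P[Fill₋(K) ∩ A = ∅] = P[K ∩ A = ∅] = Φ'_A(0)^α`.
[cite: LawlerSchrammWerner2003Restriction, §8.1 p. 31] -/
theorem IsRestrictionMeasure.map_leftFillConfig {α : ℝ} {P : Measure RestrictionConfig}
    (h : IsRestrictionMeasure α P) : IsRightRestrictionMeasure α (P.map leftFillConfig) := by
  haveI := h.isProbabilityMeasure
  refine ⟨Measure.isProbabilityMeasure_map measurable_leftFillConfig.aemeasurable, ?_⟩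
  intro A hA Φ hΦ d hd
  rw [Measure.map_apply measurable_leftFillConfig (RightConfig.measurableSet_avoid hA),
    leftFillConfig_preimage_avoid hA]
  exact h.2 hA.1 hΦ hd

/-- Under `P_α`, the `F^{ℝ₊}_ℍ(P_α)`-probability that `i ∉ K'` is the `P_α`-probability that `i`
is to the right of `K`. [folklore] -/
theorem IsRestrictionMeasure.map_leftFillConfig_setOf_notMem {α : ℝ} {P : Measure RestrictionConfig}
    (_h : IsRestrictionMeasure α P) :
    (P.map leftFillConfig) {K' : RightConfig | Complex.I ∉ (K' : Set ℂ)} = P (rightOf Complex.I) := by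
  have hI : (Complex.I : ℂ) ∈ upperHalfPlaneSet := by
    show 0 < Complex.I.im
    simp
  rw [Measure.map_apply measurable_leftFillConfig (RightConfig.measurableSet_notMem hI),
    leftFillConfig_preimage_setOf_notMem (by simp)]

/-- **`P_α(i is to the right of K) ≤ 1/2`** (proof of [LSW] Cor. 8.6, p. 38: "the same symmetry
argument shows that for any `α > 0`, if the two-sided probability measure with exponent
`α > 0` exists, then the `P_α` probability that `i` ends up to the 'right' of `K` is at most
`1/2` (it can be smaller if `K` is of positive Lebesgue measure)"): `rightOf i` is measurable
and disjoint from its mirror image, and `P_α` is `σ`-invariant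
(`IsRestrictionMeasure.measure_le_half_of_disjoint_reflect`).
[cite: LawlerSchrammWerner2003Restriction, proof of Cor. 8.6 (p. 38)] -/
theorem IsRestrictionMeasure.measure_rightOf_I_le_half {α : ℝ} {P : Measure RestrictionConfig}
    (h : IsRestrictionMeasure α P) : P (rightOf Complex.I) ≤ 1 / 2 :=
  h.measure_le_half_of_disjoint_reflect (measurableSet_rightOf (by simp))
    disjoint_rightOf_I_reflect_preimage

/-! ### [LSW] Cor. 8.6 from Thm. 8.4; the target from its two printed leaves -/

/-- **[LSW] Corollary 8.6 from its SLE(8/3, ρ) input** (proof of Cor. 8.6, p. 38): the named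
fact `not_exists_isRestrictionMeasure_of_lt_five_eighths` ("for all `α < 5/8` the two-sided
restriction probability measure `P_α` does not exist") follows from
`exists_isRightRestrictionMeasure_lt_five_eighths` (Thm. 8.4 with Lemma 8.3 and the first half
of the proof: for `0 < α < 5/8`, `P⁺_α` exists and gives probability `> 1/2` to `{i ∉ K}`). For
if `P_α` existed, its image under `F^{ℝ₊}_ℍ` would be `P⁺_α` (`map_leftFillConfig` and the
uniqueness of `P⁺_α`, `IsRightRestrictionMeasure.unique`), whence
`P⁺_α{i ∉ K} = P_α(i is to the right of K) ≤ 1/2` (`measure_rightOf_I_le_half`).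
[cite: LawlerSchrammWerner2003Restriction, Cor. 8.6 (pp. 37–38)] -/
theorem not_exists_isRestrictionMeasure_of_lt_five_eighths_of_oneSided
    (h84 : exists_isRightRestrictionMeasure_lt_five_eighths) :
    not_exists_isRestrictionMeasure_of_lt_five_eighths := by
  intro α hα hlt hex
  obtain ⟨P, hP⟩ := hex
  obtain ⟨Q, hQ, hQgt⟩ := h84 α hα hlt
  have hPQ : P.map leftFillConfig = Q := hP.map_leftFillConfig.unique hQ
  have hle : Q {K' : RightConfig | Complex.I ∉ (K' : Set ℂ)} ≤ 1 / 2 := by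
    rw [← hPQ, hP.map_leftFillConfig_setOf_notMem]
    exact hP.measure_rightOf_I_le_half
  exact absurd hQgt (not_lt.2 hle)

/-- **`5/8 ≤ α` whenever `P_α` exists** (the "only if" half of [LSW] p. 5 result 1), from the
SLE(8/3, ρ) input of Cor. 8.6 and the proved positivity of the exponent
(`IsRestrictionMeasure.five_eighths_le`). [cite: LawlerSchrammWerner2003Restriction, p. 5 result 1 with Cor. 8.6 (p. 37)] -/
theorem IsRestrictionMeasure.five_eighths_le_of_oneSided
    (h84 : exists_isRightRestrictionMeasure_lt_five_eighths) {α : ℝ}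
    {P : Measure RestrictionConfig} (h : IsRestrictionMeasure α P) : 5 / 8 ≤ α :=
  h.five_eighths_le (not_exists_isRestrictionMeasure_of_lt_five_eighths_of_oneSided h84)

/-- **[LSW] p. 5 result 2, first sentence (outer reading), from its two printed deep leaves**:
the SLE(8/3, ρ) input of Cor. 8.6 (`h84`: `exists_isRightRestrictionMeasure_lt_five_eighths`,
§8, Thm. 8.4) and the interior-point form of Thm. 7.3 (`h73`:
`IsRestrictionMeasure.ae_interior_nonempty_of_gt_five_eighths`, §7); everything else — the
positivity of the exponent, `F^{ℝ₊}_ℍ(P_α) = P⁺_α`, the symmetry bound, the measurability of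
`{int K ≠ ∅}` and the emptiness of the interior of simple curves — is proved in the tree.
[cite: LawlerSchrammWerner2003Restriction, p. 5 result 2; Thm. 7.3 (p. 29), Thm. 8.4 and Cor. 8.6 (pp. 37–38)] -/
theorem IsRestrictionMeasure.eq_five_eighths_of_outer_simple_of_leaves
    (h84 : exists_isRightRestrictionMeasure_lt_five_eighths)
    (h73 : IsRestrictionMeasure.ae_interior_nonempty_of_gt_five_eighths) :
    IsRestrictionMeasure.eq_five_eighths_of_outer_simple :=
  IsRestrictionMeasure.eq_five_eighths_of_outer_simple_of_facts
    (not_exists_isRestrictionMeasure_of_lt_five_eighths_of_oneSided h84) h73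

/-- The almost-everywhere reading (`IsRestrictionMeasure.eq_five_eighths_of_simple`) from the
same two leaves. [cite: LawlerSchrammWerner2003Restriction, p. 5 result 2; Thm. 7.3 (p. 29), Thm. 8.4 and Cor. 8.6 (pp. 37–38)] -/
theorem IsRestrictionMeasure.eq_five_eighths_of_simple_of_leaves
    (h84 : exists_isRightRestrictionMeasure_lt_five_eighths)
    (h73 : IsRestrictionMeasure.ae_interior_nonempty_of_gt_five_eighths) :
    IsRestrictionMeasure.eq_five_eighths_of_simple :=
  IsRestrictionMeasure.eq_five_eighths_of_simple_of_outer
    (IsRestrictionMeasure.eq_five_eighths_of_outer_simple_of_leaves h84 h73)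

end Literature.Probability.RandomPlanarGeometry

end
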